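import Summits.BirchSwinnertonDyer.BirchSwinnertonDyer.Theorems.RamifiedSevenEllipticUnitsTwistTransportPinned
import Literature.NumberTheory.EllipticCurves.HeckeGrossencharakterFunctionalEquation
import Literature.NumberTheory.GaloisRepresentations.DegreeOnePlacesProofs
import Literature.NumberTheory.EllipticCurves.PAdicLFunctionNeZeroProofs
import Literature.NumberTheory.EllipticCurves.LFunctionPrimeCoeff
import HarnessLib

set_option linter.dupNamespace false
set_option autoImplicit false

/-!
# K7r crux `EllipticUnitValueSevenOfGZK` (stmt-BirchSwinnertonDyer-19945), line `rubin-formula-zp` —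
# DEURING'S SHAPE FROM THE PINNING ALONE: equivariance, ramification and the split/inert value laws of
# EVERY `(1,0)` Hecke character `L`-pinned to a curve over `ℚ`
# (cell `bsd-cm`, seat `bsd-cm-k7r-c2` g17, FILE C; helper `--supports` 19945; THEOREMS ONLY, no named fact)

HONEST FRAMING. On the K7r line the PRINT stub of the registered skeleton v4.5 (`2e480adc5d67667d`) /
the adopted v4.6 candidate (`ecdbaed7b2d23501`) displays Deuring's theorem as the tree's named fact
`Deuring_exists_heckeCharacter_of_maximalCM` (Silverman ATAEC II Thm. 9.2 + Thm. 10.5 (b); littype), whose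
conclusion has FIVE clauses for the character `ψ = ψ_{E/K}`: (i) infinity type `(1, 0)`; (ii) equivariance
`ψ(c • x) = \overline{ψ(x)}` (Li–Xu §1.1, Jia §1); (iii) `ψ` unramified at `w` iff `E_K` has good reduction
at `w` (Thm. 9.2 (b)); (iv) the values above the good primes — split: `a_p = ψ(w) + ψ(cw)`, `ψ(w)ψ(cw) = p`;
inert: `a_p = 0`, `ψ(w) = −p` (Ex. 2.30, 2.32 (a), Cor. 10.4.1 (c)); (v) `L(E/ℚ, s) = L(s, ψ)` on
`re s > 3/2` (Thm. 10.5 (b)). Seat k7r-c2 g16's FILE A (`…GeneratorShapeOfPinned`, p532823) proved the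
generator shape (Prop. 10.4) for EVERY `(1,0)` character `L`-pinned to a curve over `ℚ`, from the pinning
alone. THIS FILE does the same for clauses (ii), (iii)-at-the-good-primes and (iv): they are THEOREMS about
every Hecke character `ψ` of infinity type `(1, 0)` of an imaginary quadratic field with
`heckeLFunction ψ s = V.LSeries s` (`re s > s₀`) for a curve `V/ℚ` — no CM theory, no named fact:

* §1 the complex-conjugate character `ψ̄` (EXISTENCE form `exists_conj`, no definition; the tree keeps `χ̄`
  anonymous, cf. `heckeLFunctionConj`), its ramification, values and `L(ψ̄, s) = \overline{L(ψ, s̄)}`;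
* §2 `\overline{L(V, s̄)} = L(V, s)` (integer Dirichlet coefficients);
* §3 **`isHeckeConjEquivariant_of_pinned`** — clause (ii): `L(ψ̄, s) = L(V, s) = L(ψ, s)`, so the RIGIDITY
  OF `L`-PINNING (`Rigidity.eq_or_eq_galConj_of_heckeLFunction_eq`: seats k7r-c2 (R1)–(R2), k7r-c3 (R3)–(R4),
  k7r-c4 composition, p510610…p515907) gives `ψ̄ ∈ {ψ, ψ ∘ c}`, and `ψ̄ = ψ` would make `ψ((x)_∞) = σ(x)⁻¹`
  real for all `x ∈ Kˣ`, i.e. the complex place real;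
* §4 **`isUnramifiedAt_and_values_of_pinned_of_hasGoodReduction`** — clauses (iii)/(iv) at every GOOD
  prime `p` of `V` unramified in `K`: with Weil's decomposition `ψ = ψ₀ N^{−σ}` the pinning reads
  `a_n(V) = (Σ_{N𝔞=n} g(𝔞)) n^{−σ}`, `g` the ideal function of `ψ₀` (ZERO at ramified primes), seat k7r-c3's
  `Rigidity.intCast_lFunction_eq_weightedCoeff_of_heckeLFunction_eq_LSeries`; at `n = p, p²` with
  `a_{p²} = a_p² − p` (Mathlib/tree `LFunction_apply_prime_sq_eq`) this gives, at a split `p = w·cw`,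
  `p = g(w) g(cw) p^{−2σ}` — so `g(w), g(cw) ≠ 0`: BOTH places unramified, and then the sum/product laws —
  and at an inert `p`: `a_p = 0`, `−p = g(w) p^{−2σ} ≠ 0`: unramified with `ψ(w) = −p`;
* CONSUMPTION on the K7r line is in the sequel `…DeuringNodesOfCore` (FILE C2): the two Deuring NODES of
  the v4.6 chain follow from the CORE «∃ ψ of type (1,0) with `L(ψ, s) = L(V, s)`». HONEST READING: the display
  `Deuring_exists_heckeCharacter_of_maximalCM` is ONE named fact and stays XL PRINT; a weaker display is the
  typing layer's / planner's pen; no skeleton statement changes; 19945 stays OPEN (S_pkg⁻ = [BKNO] PRE +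
  readings, S_arch = research); BSD is not proved for any curve.

References: [SilvermanATAEC1994] II Thm. 9.2, Prop. 10.4, Cor. 10.4.1, Thm. 10.5, Ex. 2.30–2.32;
[LiXu2025JNT] §1.1; [Jia2026ActaArith] §1–§2; [deShalit1987] II.1.1; [NeukirchANT1999] VII (6.9), (8.1),
I (8.2), (9.2); [Ribet1977Nebentypus] §3; [SilvermanAEC2009] C.16; [Cremona1997] Table 1 (49a1);
cell texts STATUS 2026-08-27 D231/D239/D243/D247/D248, k7r-c2 g17 14:3xZ.
-/

noncomputable section

open scoped Classical ComplexConjugate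
open Filter NumberField IsDedekindDomain WeierstrassCurve
  Literature.NumberTheory.GaloisRepresentations
  Literature.NumberTheory.LFunctions
  Literature.NumberTheory.EllipticCurves
  Literature.NumberTheory.EllipticCurves.ModularForms
  Literature.NumberTheory.EllipticCurves.Rank1Residual
  Summit.BirchSwinnertonDyer.Rank1Residual Summit.BirchSwinnertonDyer.Rank1Residual.X12
  Summit.BirchSwinnertonDyer.Rank1Residual.X12.O11

namespace Summit.BirchSwinnertonDyer.BirchSwinnertonDyer.Theorems.RamifiedSevenEllipticUnits

namespace DeuringShape

variable {K : Type} [Field K] [NumberField K]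

/-! ## §1 The complex-conjugate character `ψ̄ = conj ∘ ψ` (existence form; no definition is introduced) -/

/-- **The complex-conjugate Hecke character exists**: for every Hecke character `ψ` of `K` there is a
Hecke character `ψ̄` with `ψ̄(x) = \overline{ψ(x)}` for every idele `x` (`conj : ℂˣ → ℂˣ` is a continuous
group automorphism fixing `1`, so `conj ∘ ψ` is continuous and trivial on principal ideles). The tree
keeps `ψ̄` anonymous (`heckeLFunctionConj` is "its" `L`-function); so do we. [cite: deShalit1987, II.1.1 (3) (the character `χ̄`)] -/
theorem exists_conj (ψ : HeckeCharacter K) :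
    ∃ ψ' : HeckeCharacter K, ∀ x : ideleGroup K, ((ψ' x : ℂˣ) : ℂ) = conj ((ψ x : ℂˣ) : ℂ) := by
  let g : ideleGroup K →* ℂˣ :=
    (Units.map ((starRingEnd ℂ : ℂ →+* ℂ) : ℂ →* ℂ)).comp ψ.toContinuousMonoidHom.toMonoidHom
  have hcont : Continuous g := by
    change Continuous fun x : ideleGroup K ↦ Units.map ((starRingEnd ℂ : ℂ →+* ℂ) : ℂ →* ℂ) (ψ x)
    exact (Units.continuous_map Complex.continuous_conj).comp (map_continuous ψ)
  let f : ideleGroup K →ₜ* ℂˣ := ⟨g, hcont⟩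
  refine ⟨⟨f, fun x hx ↦ ?_⟩, fun x ↦ rfl⟩
  change Units.map ((starRingEnd ℂ : ℂ →+* ℂ) : ℂ →* ℂ) (ψ x) = 1
  rw [ψ.map_principal hx, map_one]

variable {ψ ψ' : HeckeCharacter K}

/-- `ψ̄` is unramified exactly where `ψ` is (`\overline{z} = 1 ↔ z = 1`). [cite: deShalit1987, II.1.1 (3)] -/
theorem isUnramifiedAt_iff_of_conj (hψ' : ∀ x : ideleGroup K, ((ψ' x : ℂˣ) : ℂ) = conj ((ψ x : ℂˣ) : ℂ))
    (v : HeightOneSpectrum (𝓞 K)) : ψ'.IsUnramifiedAt v ↔ ψ.IsUnramifiedAt v := by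
  simp only [HeckeCharacter.IsUnramifiedAt, HeckeCharacter.localComponent_apply]
  refine forall_congr' fun u ↦ ?_
  rw [← Units.val_eq_one, hψ', map_eq_one_iff (starRingEnd ℂ) (RingHom.injective _), Units.val_eq_one]

/-- `ψ̄(ϖ_v) = \overline{ψ(ϖ_v)}` (same chosen uniformiser). [cite: deShalit1987, II.1.1 (3)] -/
theorem valueAtUniformizer_of_conj
    (hψ' : ∀ x : ideleGroup K, ((ψ' x : ℂˣ) : ℂ) = conj ((ψ x : ℂˣ) : ℂ))
    (v : HeightOneSpectrum (𝓞 K)) : ψ'.valueAtUniformizer v = conj (ψ.valueAtUniformizer v) := by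
  simp only [HeckeCharacter.valueAtUniformizer, HeckeCharacter.localComponent_apply, hψ']

/-- **`L(ψ̄, s)` is the tree's `heckeLFunctionConj ψ s`** (the Euler product of `ψ̄` re-indexed onto the
unramified places of `ψ`). [cite: deShalit1987, II.1.1 (3)] -/
theorem heckeLFunction_of_conj
    (hψ' : ∀ x : ideleGroup K, ((ψ' x : ℂˣ) : ℂ) = conj ((ψ x : ℂˣ) : ℂ)) (s : ℂ) :
    heckeLFunction ψ' s = heckeLFunctionConj ψ s := by
  unfold heckeLFunction heckeLFunctionConj
  let e : {v : HeightOneSpectrum (𝓞 K) // ψ'.IsUnramifiedAt v} ≃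
      {w : HeightOneSpectrum (𝓞 K) // ψ.IsUnramifiedAt w} :=
    Equiv.subtypeEquivRight fun v ↦ isUnramifiedAt_iff_of_conj hψ' v
  have hre := Equiv.tprod_eq e (fun w : {w : HeightOneSpectrum (𝓞 K) // ψ.IsUnramifiedAt w} ↦
    (1 - conj (ψ.valueAtUniformizer w.1) * ((w.1.residueCard : ℂ) ^ (-s)))⁻¹)
  rw [← hre]
  exact tprod_congr fun v ↦ by rw [valueAtUniformizer_of_conj hψ']; rfl

/-- **`L(ψ̄, s) = \overline{L(ψ, s̄)}`.** [cite: deShalit1987, II.1.1 (3)] -/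
theorem heckeLFunction_of_conj_eq_conj
    (hψ' : ∀ x : ideleGroup K, ((ψ' x : ℂˣ) : ℂ) = conj ((ψ x : ℂˣ) : ℂ)) (s : ℂ) :
    heckeLFunction ψ' s = conj (heckeLFunction ψ (conj s)) := by
  rw [heckeLFunction_of_conj hψ', heckeLFunctionConj_eq_conj]

/-! ## §2 The `L`-series of a Weierstrass curve is real on the real axis: `\overline{L(V, s̄)} = L(V, s)` -/

/-- **`\overline{L(V, \bar s)} = L(V, s)`** for the `L`-series of a Weierstrass curve over a number field
(its Dirichlet coefficients `V.LFunction n` are INTEGERS): conjugation passes through the `tsum` and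
`\overline{n^{-\bar s}} = n^{-s}`. [cite: SilvermanAEC2009, App. C §16 (the L-series of E; shape only)] -/
theorem conj_LSeries_conj {F : Type} [Field F] [NumberField F] (V : WeierstrassCurve F) (s : ℂ) :
    conj (V.LSeries (conj s)) = V.LSeries s := by
  unfold WeierstrassCurve.LSeries LSeries
  rw [Complex.conj_tsum]
  refine tsum_congr fun n ↦ ?_
  rcases eq_or_ne n 0 with rfl | hn
  · simp [LSeries.term_zero]
  · rw [LSeries.term_of_ne_zero hn, LSeries.term_of_ne_zero hn, map_div₀]
    congr 1
    · simp only [Function.comp_apply, map_intCast]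
    · rw [Complex.cpow_conj _ _ (by rw [Complex.natCast_arg]; exact Real.pi_ne_zero.symm),
        Complex.conj_conj, Complex.conj_natCast]

/-! ## §3 EQUIVARIANCE FROM THE PINNING (Deuring clause (ii) as a theorem) -/

/-- **Every `(1,0)` character `L`-pinned to a curve is conj-EQUIVARIANT.** `K` imaginary quadratic with
non-trivial automorphism `c`; `ψ` a Hecke character of `K` of infinity type `(1, 0)` with
`heckeLFunction ψ s = V.LSeries s` for `re s > s₀`, `V` a Weierstrass curve over ANY number field. Then
`ψ(c • x) = \overline{ψ(x)}` for every idele `x` (`IsHeckeConjEquivariant c ψ` — clause (ii) of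
`Deuring_exists_heckeCharacter_of_maximalCM`; Li–Xu §1.1 "`φ` is anticyclotomic", Jia §1 "equivariant because
it is the Hecke character determined by an elliptic curve over `ℚ`"). PROOF: `L(ψ̄, s) = \overline{L(ψ, s̄)} =
\overline{L(V, s̄)} = L(V, s) = L(ψ, s)` (§1, §2), so the rigidity of `L`-pinning
(`Rigidity.eq_or_eq_galConj_of_heckeLFunction_eq`, seats k7r-c2/k7r-c3/k7r-c4) gives `ψ̄ = ψ` or `ψ̄ = ψ ∘ c`;
the first is absurd: `ψ((x)_∞) = σ(x)⁻¹` (`Rigidity.coe_apply_infiniteIdeles_eq_of_hasInfinityType_one_zero`)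
would be real for every `x ∈ Kˣ`, making the complex embedding `σ` real. No named fact.
[cite: Jia2026ActaArith, §1 (equivariance of the Hecke character of a CM curve over ℚ)]
[cite: LiXu2025JNT, §1.1] [cite: NeukirchANT1999, Ch. VII §6 Prop. (6.9) and §8 (8.1)] -/
theorem isHeckeConjEquivariant_of_pinned (hK : IsImaginaryQuadratic K) (c : K ≃ₐ[ℚ] K) (hc : c ≠ 1)
    {ψ : HeckeCharacter K} (hinf : ψ.HasInfinityType (fun _ ↦ 1) (fun _ ↦ 0))
    {F : Type} [Field F] [NumberField F] (V : WeierstrassCurve F) (s₀ : ℝ)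
    (hpin : ∀ s : ℂ, s₀ < s.re → heckeLFunction ψ s = V.LSeries s) :
    IsHeckeConjEquivariant c ψ := by
  obtain ⟨ψ', hψ'⟩ := exists_conj ψ
  have hL : ∀ s : ℂ, s₀ < s.re → heckeLFunction ψ' s = heckeLFunction ψ s := fun s hs ↦ by
    have hs' : s₀ < (conj s).re := by rwa [Complex.conj_re]
    rw [heckeLFunction_of_conj_eq_conj hψ', hpin (conj s) hs', conj_LSeries_conj, hpin s hs]
  rcases Rigidity.eq_or_eq_galConj_of_heckeLFunction_eq hK c hc hinf s₀ hL with h | h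
  · -- `ψ̄ = ψ`: the values `ψ((x)_∞) = σ(x)⁻¹` would all be real — impossible for a complex place
    exfalso
    haveI : IsTotallyComplex K := hK.2
    obtain ⟨w₀⟩ : Nonempty (InfinitePlace K) := inferInstance
    have hreal : ∀ x : Kˣ, conj (w₀.embedding (x : K)) = w₀.embedding (x : K) := fun x ↦ by
      have h1 := Rigidity.coe_apply_infiniteIdeles_eq_of_hasInfinityType_one_zero hK w₀ hinf x
      have h2 := hψ' (infiniteIdeles K (globalToInfiniteUnits K x))
      rw [h, h1, map_inv₀] at h2
      exact inv_injective h2.symm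
    have hσ : ComplexEmbedding.IsReal w₀.embedding := by
      rw [ComplexEmbedding.isReal_iff]
      ext x
      rcases eq_or_ne x 0 with rfl | hx
      · simp
      · simpa [ComplexEmbedding.conjugate_coe_eq] using hreal (Units.mk0 x hx)
    exact (InfinitePlace.not_isReal_iff_isComplex.mpr (IsTotallyComplex.isComplex w₀))
      (InfinitePlace.isReal_iff.mpr hσ)
  · intro x
    rw [← h]
    exact hψ' x


/-! ## §4 RAMIFICATION AND VALUES ABOVE THE GOOD PRIMES FROM THE PINNING (Deuring clauses (iii)/(iv) as theorems) -/

section GoodPrimes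

/-- The ideal function `𝔞 ↦ χ(𝔞)` of a character `mod 𝔪` VANISHES at a prime `𝔭_w ⊇ 𝔪` (a prime dividing
the modulus is not prime to it). [cite: NeukirchANT1999, Ch. VII §8 (8.1)] -/
theorem rayClassCoeffHom_asIdeal_eq_zero_of_le {𝔪 : Ideal (𝓞 K)} (f : HeightOneSpectrum (𝓞 K) → ℂ)
    {w : HeightOneSpectrum (𝓞 K)} (hle : 𝔪 ≤ w.asIdeal) : rayClassCoeffHom 𝔪 f w.asIdeal = 0 := by
  rw [rayClassCoeffHom_apply, rayClassCoeff, if_neg]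
  rintro ⟨-, hcop⟩
  have h := Ideal.isCoprime_iff_sup_eq.mp hcop
  rw [sup_eq_left.mpr hle] at h
  exact w.isPrime.ne_top h

variable {ψ : HeckeCharacter K} {V : WeierstrassCurve ℚ} [V.IsElliptic] [V.IsGloballyMinimal] {s₀ : ℝ}

/-- **Deuring's clauses (iii)/(iv) AT A GOOD PRIME, from the pinning alone.** `K` quadratic with
non-trivial automorphism `c`; `ψ` ANY Hecke character of `K` with `heckeLFunction ψ s = V.LSeries s` for
`re s > s₀`, `V/ℚ` elliptic and globally minimal; `p` a prime of GOOD reduction of `V` which is UNRAMIFIED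
in `K`, and `w ∣ p`. Then: `ψ` is UNRAMIFIED at `w`; if `p` splits (`c • w ≠ w`) then
`ψ(ϖ_w) + ψ(ϖ_{c w}) = a_p` and `ψ(ϖ_w) ψ(ϖ_{c w}) = p`; if `p` is inert (`c • w = w`) then `a_p = 0` and
`ψ(ϖ_w) = −p` — VERBATIM clause (iv) of `Deuring_exists_heckeCharacter_of_maximalCM` (Silverman II Ex. 2.30
(a)–(c), 2.32 (a)), here for every pinned character. MECHANISM: with Weil's decomposition `ψ = ψ₀‖·‖^{−σ}`
and the ideal function `g` of `ψ₀` (`g(𝔭) = ψ₀(ϖ_𝔭)` at unramified, `0` at ramified primes), the pinning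
reads `a_n(V) = (Σ_{N𝔞 = n} g(𝔞)) n^{−σ}` (`Rigidity.intCast_lFunction_eq_weightedCoeff_of_heckeLFunction_eq_LSeries`);
at `n = p, p²` with `a_{p²} = a_p² − p` (Mathlib `LFunction_apply_prime_sq_eq`): split, `p = g(w)g(cw)·p^{−2σ}`
— so neither factor vanishes —; inert, `0 = a_p` and `−p = g(w) p^{−2σ}`. Unconditional.
[cite: SilvermanATAEC1994, Ch. II Thm. 9.2 (b), Cor. 10.4.1 (c), Ex. 2.30 (a)–(c) and 2.32 (a) (the statements; here DERIVED)]
[cite: NeukirchANT1999, Ch. VII §8 (8.1)] [cite: SilvermanAEC2009, App. C §16 (a_{p²} = a_p² − p)] -/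
theorem isUnramifiedAt_and_values_of_pinned_of_hasGoodReduction (h2 : Module.finrank ℚ K = 2)
    (c : K ≃ₐ[ℚ] K) (hc : c ≠ 1) (hpin : ∀ s : ℂ, s₀ < s.re → heckeLFunction ψ s = V.LSeries s)
    {p : ℕ} [hp : Fact p.Prime] (hgood : V.HasGoodReductionAtPrime p)
    (hnd : ¬ (p : ℤ) ∣ NumberField.discr K) (w : HeightOneSpectrum (𝓞 K))
    (hw : ((p : ℕ) : 𝓞 K) ∈ w.asIdeal) :
    ψ.IsUnramifiedAt w ∧
      (c • w ≠ w →
        ψ.valueAtUniformizer w + ψ.valueAtUniformizer (c • w) = (V.frobeniusTrace p : ℂ) ∧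
          ψ.valueAtUniformizer w * ψ.valueAtUniformizer (c • w) = (p : ℂ)) ∧
      (c • w = w → V.frobeniusTrace p = 0 ∧ ψ.valueAtUniformizer w = -(p : ℂ)) := by
  -- the rational place `v = (p)` under `w`, unramified in `K`
  set v : HeightOneSpectrum (𝓞 ℚ) := w.under (𝓞 ℚ) with hv
  have hwv : w.asIdeal.under (𝓞 ℚ) = v.asIdeal := rfl
  have hgen : Rat.HeightOneSpectrum.natGenerator v = p := natGenerator_under_eq_of_natCast_mem w hp.out hw
  have he : v.asIdeal.ramificationIdxIn (𝓞 K) = 1 :=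
    ramificationIdxIn_eq_one_of_not_dvd_discr (K := K) v (by rw [hgen]; exact hnd)
  have hp0 : (p : ℂ) ≠ 0 := by exact_mod_cast hp.out.ne_zero
  -- Weil decomposition and the coefficient identity
  obtain ⟨σ, ψ₀, 𝔪, -, h𝔪, hiff, -, hval, hcoeff⟩ :=
    Rigidity.intCast_lFunction_eq_weightedCoeff_of_heckeLFunction_eq_LSeries ψ V s₀ hpin
  set g : Ideal (𝓞 K) →*₀ ℂ := rayClassCoeffHom 𝔪 fun v ↦ ψ₀.valueAtUniformizer v with hg
  have hmul : ∀ A B : Ideal (𝓞 K), A ≠ ⊥ → B ≠ ⊥ → g (A * B) = g A * g B := fun A B _ _ ↦ map_mul g A B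
  have hone : g ⊤ = 1 := by rw [← Ideal.one_eq_top, map_one]
  have hunr_of : ∀ w' : HeightOneSpectrum (𝓞 K), g w'.asIdeal ≠ 0 → ψ.IsUnramifiedAt w' :=
    fun w' hg' ↦ (hiff w').mpr fun hle ↦ hg' (rayClassCoeffHom_asIdeal_eq_zero_of_le _ hle)
  have hgval : ∀ w' : HeightOneSpectrum (𝓞 K), ψ.IsUnramifiedAt w' →
      g w'.asIdeal = ψ.valueAtUniformizer w' * ((Ideal.absNorm w'.asIdeal : ℕ) : ℂ) ^ (σ : ℂ) :=
    fun w' h ↦ by rw [hg, Rigidity.rayClassCoeffHom_asIdeal _ ((hiff w').mp h) h𝔪, hval]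
  -- `u = p^σ ≠ 0`; `p^{-σ} = u⁻¹`, `(p²)^{-σ} = u⁻²`, `(p²)^{σ} = u²`
  set u : ℂ := (p : ℂ) ^ (σ : ℂ) with hu
  have hu0 : u ≠ 0 := fun h0 ↦ hp0 ((Complex.cpow_eq_zero_iff _ _).mp h0).1
  have hw1 : ((p : ℕ) : ℂ) ^ (-(σ : ℂ)) = u⁻¹ := Complex.cpow_neg _ _
  have hw2 : ((p ^ 2 : ℕ) : ℂ) ^ (-(σ : ℂ)) = u⁻¹ * u⁻¹ := by
    rw [pow_two, Nat.cast_mul, Complex.natCast_mul_natCast_cpow, Complex.cpow_neg]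
  have hw2' : ((p ^ 2 : ℕ) : ℂ) ^ (σ : ℂ) = u * u := by
    rw [pow_two, Nat.cast_mul, Complex.natCast_mul_natCast_cpow]
  -- the two coefficients `a_p`, `a_{p²} = a_p² − p`
  have e1 := hcoeff p hp.out.ne_zero
  have e2 := hcoeff (p ^ 2) (pow_ne_zero 2 hp.out.ne_zero)
  rw [LFunction_apply_prime_eq_frobeniusTrace V p hgood, hw1] at e1
  rw [LFunction_apply_prime_sq_eq V p hgood, Int.cast_sub, Int.cast_pow, Int.cast_natCast, hw2] at e2
  set a : ℤ := V.frobeniusTrace p with ha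
  -- split or inert
  rcases exists_places_eq_pair_or_eq_singleton h2 v he with
    ⟨w₁, w₂, hne, hS, h₁, h₂⟩ | ⟨w₀, hS, hw₀⟩
  · -- SPLIT: `{w₁, w₂}`, both of norm `p`, `c • w₁ = w₂`
    have hsum : ∀ e : ℕ, NumberField.twistCount K g (p ^ e) =
        ∑ i ∈ Finset.range (e + 1), g w₁.asIdeal ^ i * g w₂.asIdeal ^ (e - i) := by
      intro e
      rw [Rigidity.twistCount_eq_finsum, ← hgen]
      exact finsum_absNorm_eq_prime_pow_of_pair g hmul hone v hne hS h₁ h₂ e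
    have hs1 : NumberField.twistCount K g p = g w₂.asIdeal + g w₁.asIdeal := by
      have := hsum 1
      rw [pow_one] at this
      rw [this, Finset.sum_range_succ, Finset.sum_range_succ, Finset.sum_range_zero]
      simp
    have hs2 : NumberField.twistCount K g (p ^ 2) =
        g w₂.asIdeal ^ 2 + g w₁.asIdeal * g w₂.asIdeal + g w₁.asIdeal ^ 2 := by
      rw [hsum 2, Finset.sum_range_succ, Finset.sum_range_succ, Finset.sum_range_succ,
        Finset.sum_range_zero]
      simp
    set x₁ := g w₁.asIdeal with hx₁
    set x₂ := g w₂.asIdeal with hx₂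
    rw [hs1] at e1
    rw [hs2] at e2
    -- `p = x₁ x₂ u⁻²`, so `x₁, x₂ ≠ 0`: both places unramified
    have hprod : (p : ℂ) = x₁ * x₂ * (u⁻¹ * u⁻¹) := by
      linear_combination ((a : ℂ) + (x₂ + x₁) * u⁻¹) * e1 - e2
    have hx₁0 : x₁ ≠ 0 := fun h0 ↦ hp0 (by rw [hprod, h0]; ring)
    have hx₂0 : x₂ ≠ 0 := fun h0 ↦ hp0 (by rw [hprod, h0]; ring)
    have hu₁ : ψ.IsUnramifiedAt w₁ := hunr_of w₁ hx₁0
    have hu₂ : ψ.IsUnramifiedAt w₂ := hunr_of w₂ hx₂0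
    -- norms `N w₁ = N w₂ = p`, hence `xᵢ = ψ(ϖ_{wᵢ}) u`
    have hm₁ : w₁.asIdeal.under (𝓞 ℚ) = v.asIdeal := by
      have : w₁ ∈ ({w₁, w₂} : Set (HeightOneSpectrum (𝓞 K))) := Set.mem_insert _ _
      rw [← hS] at this; exact this
    have hm₂ : w₂.asIdeal.under (𝓞 ℚ) = v.asIdeal := by
      have : w₂ ∈ ({w₁, w₂} : Set (HeightOneSpectrum (𝓞 K))) := Set.mem_insert_of_mem _ rfl
      rw [← hS] at this; exact this
    have hN : ∀ {w' : HeightOneSpectrum (𝓞 K)}, w'.asIdeal.under (𝓞 ℚ) = v.asIdeal →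
        w'.asIdeal.inertiaDeg (𝓞 ℚ) = 1 → ((Ideal.absNorm w'.asIdeal : ℕ) : ℂ) = p := by
      intro w' hw' hf
      rw [(absNorm_eq_natGenerator_iff (K := K) v w'.asIdeal).mpr ⟨w', rfl, hw', hf⟩, hgen]
    have hv₁ : x₁ = ψ.valueAtUniformizer w₁ * u := by rw [hx₁, hgval w₁ hu₁, hN hm₁ h₁]
    have hv₂ : x₂ = ψ.valueAtUniformizer w₂ * u := by rw [hx₂, hgval w₂ hu₂, hN hm₂ h₂]
    have hadd : ψ.valueAtUniformizer w₁ + ψ.valueAtUniformizer w₂ = (a : ℂ) := by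
      rw [hv₁, hv₂] at e1
      rw [e1]; field_simp; ring
    have hmul' : ψ.valueAtUniformizer w₁ * ψ.valueAtUniformizer w₂ = (p : ℂ) := by
      rw [hv₁, hv₂] at hprod
      rw [hprod]; field_simp
    have hc₁ : c • w₁ = w₂ := Rigidity.smul_eq_of_places_eq_pair h2 c hc v hne hS
    have hc₂ : c • w₂ = w₁ := by
      have hS' : {w' : HeightOneSpectrum (𝓞 K) | w'.asIdeal.under (𝓞 ℚ) = v.asIdeal} = {w₂, w₁} := by
        rw [hS, Set.pair_comm]
      exact Rigidity.smul_eq_of_places_eq_pair h2 c hc v hne.symm hS'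
    have hwS : w ∈ ({w₁, w₂} : Set (HeightOneSpectrum (𝓞 K))) := by rw [← hS]; exact hwv
    rcases hwS with rfl | rfl
    · refine ⟨hu₁, fun _ ↦ ⟨by rw [hc₁, hadd], by rw [hc₁, hmul']⟩, fun hfix ↦ ?_⟩
      exact absurd (hc₁.symm.trans hfix) hne.symm
    · refine ⟨hu₂, fun _ ↦ ⟨by rw [hc₂, add_comm, hadd], by rw [hc₂, mul_comm, hmul']⟩, fun hfix ↦ ?_⟩
      exact absurd (hc₂.symm.trans hfix) hne
  · -- INERT: the single place `w₀ = w` of norm `p²`, `c • w = w`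
    have hw' : w = w₀ := by
      have : w ∈ ({w₀} : Set (HeightOneSpectrum (𝓞 K))) := by rw [← hS]; exact hwv
      simpa using this
    subst hw'
    have hs1 : NumberField.twistCount K g p = 0 := by
      have h := (finsum_absNorm_eq_prime_pow_of_singleton g hmul hone v hS hw₀ 0).2
      rw [hgen, show 2 * 0 + 1 = 1 from rfl, pow_one] at h
      rw [Rigidity.twistCount_eq_finsum]; exact h
    have hs2 : NumberField.twistCount K g (p ^ 2) = g w.asIdeal := by
      have h := (finsum_absNorm_eq_prime_pow_of_singleton g hmul hone v hS hw₀ 1).1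
      rw [hgen, show 2 * 1 = 2 from rfl, pow_one] at h
      rw [Rigidity.twistCount_eq_finsum]; exact h
    rw [hs1, zero_mul] at e1
    have ha0 : a = 0 := by exact_mod_cast e1
    rw [hs2, e1] at e2
    -- `-p = g(w) u⁻²`, so `g(w) ≠ 0`: unramified; and `g(w) = ψ(ϖ_w) u²`
    have hgw : g w.asIdeal = -(p : ℂ) * (u * u) := by
      have h := e2
      field_simp at h
      linear_combination -h
    have hx0 : g w.asIdeal ≠ 0 := by
      rw [hgw]; exact mul_ne_zero (neg_ne_zero.mpr hp0) (mul_ne_zero hu0 hu0)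
    have huw : ψ.IsUnramifiedAt w := hunr_of w hx0
    have hNw : ((Ideal.absNorm w.asIdeal : ℕ) : ℂ) = ((p ^ 2 : ℕ) : ℂ) := by
      rw [absNorm_asIdeal_eq_natGenerator_pow, ← hv, hgen, hw₀]
    have hvw : ψ.valueAtUniformizer w = -(p : ℂ) := by
      have h := hgval w huw
      rw [hNw, hw2', hgw] at h
      have h' := mul_right_cancel₀ (mul_ne_zero hu0 hu0) h
      exact h'.symm
    have hcw : c • w = w := Rigidity.smul_eq_self_of_places_eq_singleton c v hS
    exact ⟨huw, fun hne ↦ absurd hcw hne, fun _ ↦ ⟨ha0, hvw⟩⟩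

/-- **Clause (iii) of Deuring, good half, for every pinned character**: a Hecke character of a quadratic
field `L`-pinned to a globally minimal elliptic curve `V/ℚ` is UNRAMIFIED at every place above a good
prime of `V` that is unramified in `K`. [cite: SilvermanATAEC1994, Ch. II Thm. 9.2 (b) with Ex. 2.30 (a), 2.31 (b) (the statement; here DERIVED)] -/
theorem isUnramifiedAt_of_pinned_of_hasGoodReduction (h2 : Module.finrank ℚ K = 2)
    (hpin : ∀ s : ℂ, s₀ < s.re → heckeLFunction ψ s = V.LSeries s)
    {p : ℕ} [Fact p.Prime] (hgood : V.HasGoodReductionAtPrime p)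
    (hnd : ¬ (p : ℤ) ∣ NumberField.discr K) (w : HeightOneSpectrum (𝓞 K))
    (hw : ((p : ℕ) : 𝓞 K) ∈ w.asIdeal) : ψ.IsUnramifiedAt w := by
  haveI : Algebra.IsQuadraticExtension ℚ K := ⟨h2⟩
  -- a non-trivial automorphism exists in a quadratic (Galois) extension
  obtain ⟨c, hc⟩ : ∃ c : K ≃ₐ[ℚ] K, c ≠ 1 := by
    by_contra! h
    have hcard := Rigidity.card_algEquiv_eq_two (K := K) h2
    haveI : Unique (K ≃ₐ[ℚ] K) := ⟨⟨1⟩, fun a ↦ h a⟩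
    rw [Nat.card_unique] at hcard
    norm_num at hcard
  exact (isUnramifiedAt_and_values_of_pinned_of_hasGoodReduction h2 c hc hpin hgood hnd w hw).1

end GoodPrimes


end DeuringShape

end Summit.BirchSwinnertonDyer.BirchSwinnertonDyer.Theorems.RamifiedSevenEllipticUnits

end
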